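/-
Copyright: lit-balaban Phase-2 proof seat p30 (gen 26).  Statement-level skeleton of a published paper; no proof claims beyond what the
kernel checks below.
-/
import Literature.MathematicalPhysics.QuantumFieldTheory.BalabanImbrieJaffe1984to88.BIJ85FlatPropagatorKernelDiffs
import Literature.MathematicalPhysics.QuantumFieldTheory.Balaban1983to89.B3Ineq211ZeroTorus
import Literature.MathematicalPhysics.QuantumFieldTheory.Balaban1983to89.B3Bound323ZeroTorus

/-!
# [BalabanImbrieJaffe1985] §7.3 p. 326 / [Balaban1983RegularityDecay] (1.9) — kernel inputs for the HÖLDER member of the decay of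
# `G_k(u)` at non-flat small fields: **the Hölder laws, in the row variable, of the first and of the mixed second lattice differences
# of the flat torus block propagator `G_k(T_ε,0)`**:
# `|Δ_{x₁→x₂}∇_xG(·,z)| ≤ Cε²|x₁−x₂|_∞^α·max(R,1)^{−(d−1+α)}`, `|Δ_{x₁→x₂}∇_x∇_zG(·,z)| ≤ Cε²|x₁−x₂|_∞^α·max(R,1)^{−(d+α)}`,
# `R = min(|x₁−z|_∞,|x₂−z|_∞)`, `0 ≤ α < 1`, `d ≥ 2`, uniform in the volume and in `1 ≤ k ≤ K`

T. Bałaban, J. Imbrie, A. Jaffe, *Renormalization of the Higgs model: minimizers, propagators and the stability of mean field theory*,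
Commun. Math. Phys. **97** (1985) 299–329 [BalabanImbrieJaffe1985], §7.3 p. 326 [PDF 28]; T. Bałaban, *(Higgs)₂,₃ quantum fields in a
finite volume. III. Renormalization*, Commun. Math. Phys. **88** (1983) 411–445 [Balaban1983Higgs3], (2.10)–(2.11) p. 426 [PDF 16],
p. 437 [PDF 27]; [7] of [BalabanImbrieJaffe1985] = T. Bałaban, *Regularity and decay of lattice Green's functions*, Commun. Math. Phys.
**89** (1983) 571–597 [Balaban1983RegularityDecay], (1.9) p. 573, Lemma 2.4 (2.35)–(2.37) p. 582.

statement-level skeleton of published theorems with citation tags; proofs where landed; nothing here is a claim about the Yang–Mills mass gap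

CITATION HEADER (lean-in-tree rule).  Part of the lit-balaban TYPED SKELETON (HOME `run/shared/lean/pub/lit-balaban/`), PHASE-2 proof seat
p30 gen 26 (unit `lit-balaban-p30-g26`; TAKING line HOME/STATUS.md 2026-08-23T01:01:50Z; free-target protocol G.5-34(d) — the residual of
item 3 of the owner's `HOME/lit-balaban-r15/C1-CLOSURE.md` §5 (owner r15, referee ref-5): *"Still free here (M/L): the … Hölder
(1.9)-shape members at small non-flat u"*, = this seat's gen-25 HANDOFF *"NATURAL EXTENSIONS (not taken): … the Hölder member (1.9)"*).
WHAT THIS FILE IS: kernel file 1 of 2 of the Hölder member — the KERNEL INPUTS (row **C1.Eq7.3.1-7.3.2** of `HOME/lit-balaban-r15/ROWS-C1.md`,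
a located input of a located member; no head effect); the zero-field torus objects are those of rows B3.Eq2.10 / B3.Eq2.11 (owner r15).
Companion of this seat's `BIJ85FlatPropagatorKernelDiffs` (p343711: the first difference and the mixed second difference WITHOUT the
Hölder quotient).  Kind «model-level theorems only» (no new definition, no `Prop`-valued fact introduced).

THE PRINTED TEXT (verbatim).  [BalabanImbrieJaffe1985] p. 326 [PDF 28]: *"The propagators arising from Δ_k(u_k), under the restriction
(7.3.1) on the gauge field, also satisfy the regularity and decay estimates of [7]."*  [7] (1.9) p. 573 (as transcribed in the tree's
`Balaban1983to89.B4Thm19ZeroTorus`): *"(1/|x − x′|^α)|U(A(Γ_{x,x′}))(D^η_{A,μ}G_k(Ω, A)f)(x′) − (D^η_{A,μ}G_k(Ω, A)f)(x)| ≤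
c₀exp(−δ₀ dist({x, x′}, supp f))‖f‖_∞ (1.9) … c₀ on α also"*.  [Balaban1983Higgs3] p. 426 [PDF 16]: *"and if the propagator is
differentiated, then for each differentiation, there is an additional factor (L^jη)^{−1} on the right side. This applies also to Hölder
norms, e.g. we have (1/|x₂−x₁|^α)|…(D^η_{B̃,μ}G^η_{(j)})(Ω,B̃;x₂,x) − (D^η_{B̃,μ}G^η_{(j)})(Ω,B̃;x₁,x)| ≤ O(1)(L^jη)^{−d+1−α}
e^{−δ₁(L^jη)^{−1}dist({x₁,x₂},x)} (2.11)"*; p. 437 [PDF 27]: *"|G^ξ_{j″}(0; y, y′)| ≦ O(1)e^{−δ₀|y−y′|}/|y − y′|, and the corresponding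
inequalities for derivatives"*.

THE OBJECT.  `G = (B1RG242Torus.tower P a msq).G k`, Bałaban's zero-field scalar torus block propagator `G_k(T_ε,0) =
(−Δ^ε + m² + a_k(L^kε)^{−2}Q_k^*Q_k)^{−1}` (pv07's tower), a real matrix on the fine torus `T^{(0)} = Site P 0` in the counting-measure
normalisation; at `m² = 0` it is, entrywise, p31's flat covariant block propagator `gBox (α_kL^{kd}) ε⁻¹ 1 k T` of [BalabanImbrieJaffe1985]
(4.6.2) (`BIJ88NeumannPropagatorFlatDecay.gBox_flat_eq_tower`).  Its scale pieces `G^η_{(j)} = pieceT P a msq k j` ([Balaban1983Higgs3]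
(2.6); p03's `B3Ineq210ZeroTorus`, `Σ_{j<k} pieceT j = G`) obey the per-piece Hölder bound (2.11) in the row variable
(p03's `B3Ineq211ZeroTorus.ineq211At_zeroTorusH`: `η^{−d}|(∂^η_μG_{(j)})(x₂,x) − (∂^η_μG_{(j)})(x₁,x)|/|x₁−x₂|^α ≤
C(L^jη)^{1−d−α}e^{−δ₁dist({x₁,x₂},x)/L^jη}`) and the twice-differentiated (2.10) (p20's `B3Ineq210MixedTorus`).

THE MECHANISM.  (§1) The sum over the scales with a REAL exponent `p ≥ 1`: `Σ_{j<k}(L^j)^{−p}e^{−δn/L^j} ≤ C_p·max(n,1)^{−p}` — from this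
seat's natural-exponent `BIJ85FlatPropagatorKernelDiffs.scaleSum_le_max` at `⌊p⌋` and `⌈p⌉` through `t^p ≤ t^{⌊p⌋} + t^{⌈p⌉}` (`t ≥ 0`).
(§2) THE MIXED HÖLDER BOUND PER PIECE (new; print's *"This applies also to Hölder norms"* for the twice-differentiated kernel): the row
difference of p20's `mixedT_term_apply` is `a_j²L^{−jd}Σ_{y,y′}[K1_j(μ;x₂,y) − K1_j(μ;x₁,y)]C^{(j)}(y,y′)K1_j(ν;x′,y′)` — `K1_j` on both
ends —, so p03's route applies verbatim with the third kernel `K1_j(ν;x′,·)` ((2.35)) in place of `(Q_jG_j^{resc})(·,x′)`: near pairs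
`|x₁−x₂|_T ≤ L^j` by [7] Lemma 2.4 (2.36) on the torus (p38's `B4Lemma24TorusScales.holder236_torus`, in p03's block form) convolved with
(2.37), (2.35) (`B4Thm110ZeroTorus.conv_bound`); far pairs by the triangle inequality and p20's `abs_mixedPieceT_le_of`; the `j = 0` piece
is always far.  Result `ineq211_mixed_zeroTorus`: `η^{−d}|(∂_μG_{(j)}∂_νᵀ)(x₂,x′) − (∂_μG_{(j)}∂_νᵀ)(x₁,x′)|/(η|x₁−x₂|_T)^α ≤
C((L^jη)^d)^{−1}((L^jη)^α)^{−1}e^{−δ₁min(|x₁−x′|_T,|x₂−x′|_T)/L^j}`, per-α constants.  (§3) Summing (2.11) and §2 over the scales with §1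
at `p = d−1+α`, resp. `p = d+α`: the `ε`-powers collapse to `ε²` and the sum produces the near-diagonal laws `R^{−(d−1+α)}`, `R^{−(d+α)}`.

WHAT IS PROVED (0 `sorry`; standard axioms; no definition).
* §1 **`scaleSum_rpow_le_max`**: `L > 1`, `δ > 0`, real `p ≥ 1` ⇒ `∃ C > 0 ∀ k n, Σ_{j<k}((L^j)⁻¹)^p e^{−δn/L^j} ≤ C/max(n,1)^p`.
* §2 `mixedT_term_sub_apply`, `mixedHolderFar_le_of`, `mixedHolderNear_le_of` (one volume, kernel inputs), **`ineq211_mixed_zeroTorus`**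
  (hypothesis-free, volume-uniform, per α: `d ≥ 1`, odd `L > 1`, `a > 0`, `m² ≥ 0`, `0 ≤ α < 1`).
* §3 **`flat_kernel_holder`**: for `d ≥ 2`, odd `L > 1`, `a > 0`, `m² ≥ 0`, `0 ≤ α < 1` there is `C > 0` (a function of `d, L, a, m², α`)
  with, for EVERY volume `P` (`P.d = d`, `P.L = L`), every `1 ≤ k ≤ K`, all `μ, ν, x₁, x₂, z`, `ρ = |x₁−x₂|_∞`, `R = min(|x₁−z|_∞,|x₂−z|_∞)`:
  `|(G(x₂+e_μ,z) − G(x₂,z)) − (G(x₁+e_μ,z) − G(x₁,z))| ≤ Cε²ρ^α/max(R,1)^{d−1+α}` and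
  `|Δ_{x₁→x₂}[G(x+e_μ,z+e_ν) − G(x+e_μ,z) − G(x,z+e_ν) + G(x,z)]| ≤ Cε²ρ^α/max(R,1)^{d+α}`.

HONEST SCOPE.  `A = 0`, `U ≡ 1`, whole torus, `d ≥ 2` for §3 (at `d = 1` the piece bounds do not sum uniformly in `k`); forward differences;
differences in the ROW variable only (the column Hölder laws follow by the symmetry of `G` and are not restated); per-α constants (the
decl of record `Ineq211At`; [7] p. 573 «c₀ on α also»); the exponential factor of the piece bounds is discarded after the scale sum (not
needed downstream); existential constants.  Nothing here is summit progress.  Unit `lit-balaban-p30` (literature-prover-lit-balaban-p30-g26-0),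
HOME `run/shared/lean/pub/lit-balaban/`, 2026-08-23.
-/

open scoped BigOperators
open Finset Matrix

namespace Literature.MathematicalPhysics.QuantumFieldTheory.BalabanImbrieJaffe1984to88.BIJ85FlatPropagatorKernelHolder

open Literature.MathematicalPhysics.QuantumFieldTheory.Balaban1983to89
open B1RG242Torus B5Display136Torus B5Leaf237C0Torus B4Ineq115Torus B5Ineq137Torus B4Ineq116Torus B4Thm110ZeroTorus
open B3GkZeroTorusPointwise (exp_block_le)
open B4Lemma24TorusScales (holder236_torus)
open B3Sect2StatementsPart2 B3Ineq210ZeroTorus B3Ineq210MixedTorus B3Ineq211ZeroTorus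
open LatticeFieldCalculus (supDist)
open B3Sect3ScalarSelfEnergy (d1Kernel)
open B3Sect3VectorSelfEnergy (d2Kernel)
open B3Sect3KernelsZeroTorus (gpiece)
open BIJ85FlatPropagatorKernelDiffs (scaleSum_le_max diff₁_eq_sum_pieces diff₂_eq_sum_pieces)
open B3Bound323ZeroTorus (T_eq_supDist)

noncomputable section

/-! ## §1 The sum over the scales with a real exponent -/

section ScaleSum

/-- kernel: `t^p ≤ t^{⌊p⌋} + t^{⌈p⌉}` for `t ≥ 0` and `p ≥ 1` (the smaller exponent dominates below `1`, the larger above). [folklore] -/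
private theorem rpow_le_pow_floor_add_pow_ceil {t p : ℝ} (ht : 0 ≤ t) (hp : 1 ≤ p) :
    t ^ p ≤ t ^ ⌊p⌋₊ + t ^ ⌈p⌉₊ := by
  have hp0 : 0 ≤ p := by linarith
  rcases ht.eq_or_lt with h0 | hpos
  · rw [← h0, Real.zero_rpow (by linarith)]
    positivity
  rcases le_total t 1 with h1 | h1
  · have h : t ^ p ≤ t ^ ((⌊p⌋₊ : ℕ) : ℝ) :=
      Real.rpow_le_rpow_of_exponent_ge hpos h1 (Nat.floor_le hp0)
    rw [Real.rpow_natCast] at h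
    exact h.trans (le_add_of_nonneg_right (pow_nonneg ht _))
  · have h : t ^ p ≤ t ^ ((⌈p⌉₊ : ℕ) : ℝ) := Real.rpow_le_rpow_of_exponent_le h1 (Nat.le_ceil p)
    rw [Real.rpow_natCast] at h
    exact h.trans (le_add_of_nonneg_left (pow_nonneg ht _))

/-- **THE SCALE SUM WITH A REAL EXPONENT**: for `L > 1`, `δ > 0` and a real `p ≥ 1` there is `C > 0` (the sum of the constants of
`BIJ85FlatPropagatorKernelDiffs.scaleSum_le_max` at the natural exponents `⌊p⌋`, `⌈p⌉`) such that for every `k` and every lattice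
distance `n ∈ ℕ`: `Σ_{j<k}((L^j)⁻¹)^p·e^{−δn/L^j} ≤ C·max(n,1)^{−p}` — the mechanism that turns the per-scale Hölder bounds
`(L^jη)^{−(d−1+α)}`, `(L^jη)^{−(d+α)}` of (2.11) into the near-diagonal laws `|x−x′|^{−(d−1+α)}`, `|x−x′|^{−(d+α)}`.
[cite: Balaban1983Higgs3, (2.10)–(2.11) p.426] -/
theorem scaleSum_rpow_le_max {L δ : ℝ} (hL : 1 < L) (hδ : 0 < δ) {p : ℝ} (hp : 1 ≤ p) :
    ∃ C : ℝ, 0 < C ∧ ∀ k n : ℕ,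
      ∑ j ∈ range k, ((L ^ j)⁻¹) ^ p * Real.exp (-(δ * n / L ^ j)) ≤ C / (max (n : ℝ) 1) ^ p := by
  have hp0 : 0 ≤ p := by linarith
  have hfl : 1 ≤ ⌊p⌋₊ := Nat.le_floor (by exact_mod_cast hp)
  have hce : 1 ≤ ⌈p⌉₊ := le_trans hfl (Nat.floor_le_ceil p)
  obtain ⟨C₁, hC₁, h₁⟩ := scaleSum_le_max hL hδ (p := ⌊p⌋₊) hfl
  obtain ⟨C₂, hC₂, h₂⟩ := scaleSum_le_max hL hδ (p := ⌈p⌉₊) hce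
  refine ⟨C₁ + C₂, by positivity, fun k n => ?_⟩
  have hL0 : 0 < L := by linarith
  set M : ℝ := max (n : ℝ) 1 with hM
  have hM1 : 1 ≤ M := le_max_right _ _
  have hM0 : 0 < M := by linarith
  -- per term: `((L^j)⁻¹)^p = (M⁻¹)^p (M(L^j)⁻¹)^p ≤ (M⁻¹)^p (M^⌊p⌋((L^j)⁻¹)^⌊p⌋ + M^⌈p⌉((L^j)⁻¹)^⌈p⌉)`
  have hterm : ∀ j : ℕ, ((L ^ j)⁻¹) ^ p ≤
      (M⁻¹) ^ p * (M ^ ⌊p⌋₊ * ((L ^ j)⁻¹) ^ ⌊p⌋₊ + M ^ ⌈p⌉₊ * ((L ^ j)⁻¹) ^ ⌈p⌉₊) := by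
    intro j
    have hx : 0 ≤ (L ^ j)⁻¹ := inv_nonneg.2 (pow_nonneg hL0.le j)
    have hsplit : ((L ^ j)⁻¹) ^ p = (M⁻¹) ^ p * (M * (L ^ j)⁻¹) ^ p := by
      rw [← Real.mul_rpow (inv_nonneg.2 hM0.le) (mul_nonneg hM0.le hx), ← mul_assoc, inv_mul_cancel₀ hM0.ne', one_mul]
    rw [hsplit]
    refine mul_le_mul_of_nonneg_left ?_ (Real.rpow_nonneg (inv_nonneg.2 hM0.le) p)
    have h := rpow_le_pow_floor_add_pow_ceil (mul_nonneg hM0.le hx) hp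
    rw [mul_pow, mul_pow] at h
    exact h
  have hsum : ∑ j ∈ range k, ((L ^ j)⁻¹) ^ p * Real.exp (-(δ * n / L ^ j)) ≤
      (M⁻¹) ^ p * (M ^ ⌊p⌋₊ * ∑ j ∈ range k, ((L ^ j)⁻¹) ^ ⌊p⌋₊ * Real.exp (-(δ * n / L ^ j)) +
        M ^ ⌈p⌉₊ * ∑ j ∈ range k, ((L ^ j)⁻¹) ^ ⌈p⌉₊ * Real.exp (-(δ * n / L ^ j))) := by
    rw [Finset.mul_sum, Finset.mul_sum, ← Finset.sum_add_distrib, Finset.mul_sum]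
    refine Finset.sum_le_sum fun j _ => ?_
    have he : 0 ≤ Real.exp (-(δ * n / L ^ j)) := (Real.exp_pos _).le
    calc ((L ^ j)⁻¹) ^ p * Real.exp (-(δ * n / L ^ j))
        ≤ (M⁻¹) ^ p * (M ^ ⌊p⌋₊ * ((L ^ j)⁻¹) ^ ⌊p⌋₊ + M ^ ⌈p⌉₊ * ((L ^ j)⁻¹) ^ ⌈p⌉₊) * Real.exp (-(δ * n / L ^ j)) :=
          mul_le_mul_of_nonneg_right (hterm j) he
      _ = _ := by ring
  refine hsum.trans ?_
  have hq₁ : M ^ ⌊p⌋₊ * ∑ j ∈ range k, ((L ^ j)⁻¹) ^ ⌊p⌋₊ * Real.exp (-(δ * n / L ^ j)) ≤ C₁ := by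
    calc M ^ ⌊p⌋₊ * ∑ j ∈ range k, ((L ^ j)⁻¹) ^ ⌊p⌋₊ * Real.exp (-(δ * n / L ^ j))
        ≤ M ^ ⌊p⌋₊ * (C₁ / M ^ ⌊p⌋₊) := mul_le_mul_of_nonneg_left (h₁ k n) (by positivity)
      _ = C₁ := by field_simp
  have hq₂ : M ^ ⌈p⌉₊ * ∑ j ∈ range k, ((L ^ j)⁻¹) ^ ⌈p⌉₊ * Real.exp (-(δ * n / L ^ j)) ≤ C₂ := by
    calc M ^ ⌈p⌉₊ * ∑ j ∈ range k, ((L ^ j)⁻¹) ^ ⌈p⌉₊ * Real.exp (-(δ * n / L ^ j))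
        ≤ M ^ ⌈p⌉₊ * (C₂ / M ^ ⌈p⌉₊) := mul_le_mul_of_nonneg_left (h₂ k n) (by positivity)
      _ = C₂ := by field_simp
  calc (M⁻¹) ^ p * (M ^ ⌊p⌋₊ * ∑ j ∈ range k, ((L ^ j)⁻¹) ^ ⌊p⌋₊ * Real.exp (-(δ * n / L ^ j)) +
        M ^ ⌈p⌉₊ * ∑ j ∈ range k, ((L ^ j)⁻¹) ^ ⌈p⌉₊ * Real.exp (-(δ * n / L ^ j)))
      ≤ (M⁻¹) ^ p * (C₁ + C₂) := mul_le_mul_of_nonneg_left (add_le_add hq₁ hq₂) (Real.rpow_nonneg (inv_nonneg.2 hM0.le) p)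
    _ = (C₁ + C₂) / M ^ p := by rw [Real.inv_rpow hM0.le, mul_comm, div_eq_mul_inv]

end ScaleSum

/-! ## §2 The Hölder law of the twice-differentiated pieces `∂_μG^η_{(j)}∂_νᵀ` in the row variable -/

section MixedHolder

variable {P : Params} {a msq : ℝ}

/-- kernel: the scale factors — `ε^{−d}·L^{−jd} = ((L^jε)^d)^{−1}`. [folklore] -/
private theorem eps_weight_zero' (j : ℕ) :
    (P.eps ^ P.d)⁻¹ * (((P.L : ℝ) ^ j) ^ P.d)⁻¹ = (P.spacing j ^ P.d)⁻¹ := by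
  unfold Params.spacing
  rw [mul_pow ((P.L : ℝ) ^ j) P.eps P.d, mul_inv, mul_comm]

/-- kernel: `(L^jη)^{−1}·(η·t) = t/L^j`. [folklore] -/
private theorem scale_inv_mul' (j : ℕ) (t : ℝ) : (P.spacing j)⁻¹ * (P.eps * t) = t / (P.L : ℝ) ^ j := by
  have hε : P.eps ≠ 0 := P.eps_pos.ne'
  unfold Params.spacing
  rw [mul_inv, div_eq_mul_inv]
  calc ((P.L : ℝ) ^ j)⁻¹ * P.eps⁻¹ * (P.eps * t) = t * ((P.L : ℝ) ^ j)⁻¹ * (P.eps⁻¹ * P.eps) := by ring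
    _ = t * ((P.L : ℝ) ^ j)⁻¹ := by rw [inv_mul_cancel₀ hε, mul_one]

/-- kernel: the torus distance of two distinct fine sites is at least one lattice unit. [folklore] -/
private theorem one_le_T_of_ne' {x x' : Site P 0} (hne : x ≠ x') : 1 ≤ T P 0 x x' := by
  rw [T_eq_supDist]
  have h : supDist x x' ≠ 0 := fun h0 => hne ((B3TorusRadialSums.supDist_eq_zero_iff x x').1 h0)
  exact_mod_cast Nat.one_le_iff_ne_zero.2 h

/-- The DIFFERENCE of two rows of the twice-differentiated `j`-th term of [7] (2.34) (p20's `mixedT_term_apply` twice):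
`(∂_μterm_j∂_νᵀ)(x₂,x′) − (∂_μterm_j∂_νᵀ)(x₁,x′) = a_j²L^{−jd}Σ_{y,y′}[K1_j(μ;x₂,y) − K1_j(μ;x₁,y)]C^{(j)}(y,y′)K1_j(ν;x′,y′)` — the
quantity whose Hölder quotient is bounded through the Hölder quotient (2.36) of `K1_j`.
[cite: Balaban1983Higgs3, (2.10)–(2.11) p.426; Balaban1983RegularityDecay, (2.34)–(2.36) p.582] -/
theorem mixedT_term_sub_apply (ha : 0 < a) (hm : 0 ≤ msq) {j : ℕ} (hj1 : 1 ≤ j) (hj : j ≤ P.m + P.K) (μ ν : Fin P.d)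
    (x₁ x₂ x' : Site P 0) :
    mixedT P P.eps μ ν ((tower P a msq).term j) x₂ x' - mixedT P P.eps μ ν ((tower P a msq).term j) x₁ x'
      = B1.aSeq a P.L j ^ 2 * (((P.L : ℝ) ^ j) ^ P.d)⁻¹ *
        ∑ y : Site P j, ∑ y' : Site P j,
          (K1 P a msq j μ x₂ ⟨j, y⟩ - K1 P a msq j μ x₁ ⟨j, y⟩) * Crs P a msq j y y' * K1 P a msq j ν x' ⟨j, y'⟩ := by
  rw [mixedT_term_apply ha hm hj1 hj μ ν x₂ x', mixedT_term_apply ha hm hj1 hj μ ν x₁ x', ← mul_sub, ← Finset.sum_sub_distrib]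
  congr 1
  refine Finset.sum_congr rfl fun y _ => ?_
  rw [← Finset.sum_sub_distrib]
  refine Finset.sum_congr rfl fun y' _ => ?_
  ring

/-- **The mixed Hölder law, FAR PAIRS `|x₁ − x₂|_T ≥ L^j`, every `j`, at one volume under the kernel inputs** (the triangle inequality
and p20's twice-differentiated (2.10) `abs_mixedPieceT_le_of`; the weight `|x₁−x₂|^{−α} ≤ (L^jη)^{−α}` for `α ≥ 0`):
`η^{−d}|(∂_μG_{(j)}∂_νᵀ)(x₂,x′) − (∂_μG_{(j)}∂_νᵀ)(x₁,x′)|/(η|x₁−x₂|_T)^α ≤ 2C_mix·((L^jη)^d)^{−1}((L^jη)^α)^{−1}·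
e^{−min(δ₀,δ/2)·min(|x₁−x′|_T,|x₂−x′|_T)/L^j}`. [cite: Balaban1983Higgs3, (2.10)–(2.11) p.426] -/
theorem mixedHolderFar_le_of (ha : 0 < a) (hm : 0 ≤ msq) {k : ℕ} (hkm : k ≤ P.m + P.K) {C δ C₀ δ₀ : ℝ}
    (hC : 0 ≤ C) (hδ : 0 < δ) (hC₀ : 0 ≤ C₀) (hδ₀ : 0 < δ₀) (hK : KerBounds P a msq k C δ)
    (hG0 : ∀ x x' : Site P 0, |G0unit P a msq x x'| ≤ C₀ * Real.exp (-(δ₀ * T P 0 x x')))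
    {α : ℝ} (hα0 : 0 ≤ α) (j : ℕ) (μ ν : Fin P.d) {x₁ x₂ : Site P 0} (hfar : (P.L : ℝ) ^ j ≤ T P 0 x₁ x₂) (x' : Site P 0) :
    (P.eps ^ P.d)⁻¹ * |mixedT P P.eps μ ν (pieceT P a msq k j) x₂ x' - mixedT P P.eps μ ν (pieceT P a msq k j) x₁ x'|
        / (P.eps * T P 0 x₁ x₂) ^ α
      ≤ 2 * (4 * C₀ * Real.exp (2 * δ₀) + a ^ 2 * (C ^ 3 * B4Sect5Proof.latticeConst P.d (δ / 2) ^ 2 * Real.exp δ))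
          * ((P.spacing j ^ P.d)⁻¹ * (P.spacing j ^ α)⁻¹)
          * Real.exp (-(min δ₀ (δ / 2) * (min (T P 0 x₁ x') (T P 0 x₂ x') / (P.L : ℝ) ^ j))) := by
  have hε := P.eps_pos
  have hεd : 0 < (P.eps ^ P.d)⁻¹ := by positivity
  have hs := P.spacing_pos j
  have hLj : 0 < (P.L : ℝ) ^ j := pow_pos P.cast_L_pos j
  have hm0 : 0 ≤ min δ₀ (δ / 2) := le_min hδ₀.le (by positivity)
  have h1 := abs_mixedPieceT_le_of ha hm hkm hC hδ hC₀ hδ₀ hK hG0 j μ ν x₁ x'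
  have h2 := abs_mixedPieceT_le_of ha hm hkm hC hδ hC₀ hδ₀ hK hG0 j μ ν x₂ x'
  have hCd0 : 0 ≤ 4 * C₀ * Real.exp (2 * δ₀) + a ^ 2 * (C ^ 3 * B4Sect5Proof.latticeConst P.d (δ / 2) ^ 2 * Real.exp δ) := by
    positivity
  set Cd := 4 * C₀ * Real.exp (2 * δ₀) + a ^ 2 * (C ^ 3 * B4Sect5Proof.latticeConst P.d (δ / 2) ^ 2 * Real.exp δ)
  have hw₁0 : 0 ≤ (P.spacing j ^ P.d)⁻¹ := by positivity
  set w₁ := (P.spacing j ^ P.d)⁻¹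
  set E := Real.exp (-(min δ₀ (δ / 2) * (min (T P 0 x₁ x') (T P 0 x₂ x') / (P.L : ℝ) ^ j)))
  have hE0 : 0 < E := Real.exp_pos _
  have e1 : Real.exp (-(min δ₀ (δ / 2) * (T P 0 x₁ x' / (P.L : ℝ) ^ j))) ≤ E := by
    refine Real.exp_le_exp.2 (neg_le_neg (mul_le_mul_of_nonneg_left ?_ hm0))
    exact div_le_div_of_nonneg_right (min_le_left _ _) hLj.le
  have e2 : Real.exp (-(min δ₀ (δ / 2) * (T P 0 x₂ x' / (P.L : ℝ) ^ j))) ≤ E := by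
    refine Real.exp_le_exp.2 (neg_le_neg (mul_le_mul_of_nonneg_left ?_ hm0))
    exact div_le_div_of_nonneg_right (min_le_right _ _) hLj.le
  -- numerator: the triangle inequality and the mixed clause at `x₁` and at `x₂`
  have hnum : (P.eps ^ P.d)⁻¹ *
      |mixedT P P.eps μ ν (pieceT P a msq k j) x₂ x' - mixedT P P.eps μ ν (pieceT P a msq k j) x₁ x'|
        ≤ 2 * Cd * w₁ * E := by
    calc (P.eps ^ P.d)⁻¹ *
        |mixedT P P.eps μ ν (pieceT P a msq k j) x₂ x' - mixedT P P.eps μ ν (pieceT P a msq k j) x₁ x'|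
        ≤ (P.eps ^ P.d)⁻¹ * (|mixedT P P.eps μ ν (pieceT P a msq k j) x₂ x'|
            + |mixedT P P.eps μ ν (pieceT P a msq k j) x₁ x'|) :=
          mul_le_mul_of_nonneg_left (abs_sub _ _) hεd.le
      _ = (P.eps ^ P.d)⁻¹ * |mixedT P P.eps μ ν (pieceT P a msq k j) x₂ x'|
            + (P.eps ^ P.d)⁻¹ * |mixedT P P.eps μ ν (pieceT P a msq k j) x₁ x'| := mul_add _ _ _
      _ ≤ Cd * w₁ * E + Cd * w₁ * E :=
          add_le_add (h2.trans (mul_le_mul_of_nonneg_left e2 (mul_nonneg hCd0 hw₁0)))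
            (h1.trans (mul_le_mul_of_nonneg_left e1 (mul_nonneg hCd0 hw₁0)))
      _ = 2 * Cd * w₁ * E := by ring
  -- denominator: `(η|x₁−x₂|_T)^α ≥ (L^jη)^α`
  have hsα : 0 < P.spacing j ^ α := Real.rpow_pos_of_pos hs α
  have hden : P.spacing j ^ α ≤ (P.eps * T P 0 x₁ x₂) ^ α := by
    refine Real.rpow_le_rpow hs.le ?_ hα0
    unfold Params.spacing
    rw [mul_comm]
    exact mul_le_mul_of_nonneg_left hfar hε.le
  calc (P.eps ^ P.d)⁻¹ *
        |mixedT P P.eps μ ν (pieceT P a msq k j) x₂ x' - mixedT P P.eps μ ν (pieceT P a msq k j) x₁ x'|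
          / (P.eps * T P 0 x₁ x₂) ^ α
      ≤ (2 * Cd * w₁ * E) / P.spacing j ^ α := div_le_div₀ (by positivity) hnum hsα hden
    _ = 2 * Cd * (w₁ * (P.spacing j ^ α)⁻¹) * E := by rw [div_eq_mul_inv]; ring

/-- **The mixed Hölder law, NEAR PAIRS `0 < |x₁ − x₂|_T ≤ L^j`, `j ≥ 1`, at one volume under the kernel inputs** (`KerBounds`: (2.35),
(2.37); `hH`: the torus (2.36) input at level `j` in block form — `(L^j/|x₁−x₂|_T)^α|K1_j(μ;x₂,y) − K1_j(μ;x₁,y)| ≤ Ce^{−δ|proj x₁ − y|}`):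
`η^{−d}|(∂_μG_{(j)}∂_νᵀ)(x₂,x′) − (∂_μG_{(j)}∂_νᵀ)(x₁,x′)|/(η|x₁−x₂|_T)^α ≤ a²C³K_d(δ/2)²e^{δ}·((L^jη)^d)^{−1}((L^jη)^α)^{−1}·
e^{−(δ/2)|x₁−x′|_T/L^j}` (the Hölder quotient of the twice-differentiated term is the convolution of the Hölder quotient (2.36) of `K1_j`
with (2.37) and (2.35) — `K1_j(ν;x′,·)` the third kernel). [cite: Balaban1983Higgs3, (2.10)–(2.11) p.426;
Balaban1983RegularityDecay, (2.34)–(2.36) p.582] -/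
theorem mixedHolderNear_le_of (ha : 0 < a) (hm : 0 ≤ msq) {k : ℕ} (hkm : k ≤ P.m + P.K) {C δ : ℝ} (hC : 0 ≤ C) (hδ : 0 < δ)
    (hK : KerBounds P a msq k C δ) {j : ℕ} (hj1 : 1 ≤ j) {α : ℝ}
    (hH : j < k → ∀ (μ : Fin P.d) (x₁ x₂ : Site P 0), x₂ ≠ x₁ → T P 0 x₁ x₂ ≤ (P.L : ℝ) ^ j → ∀ y : Site P j,
      ((P.L : ℝ) ^ j / T P 0 x₁ x₂) ^ α * |K1 P a msq j μ x₂ ⟨j, y⟩ - K1 P a msq j μ x₁ ⟨j, y⟩|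
        ≤ C * Real.exp (-(δ * T P j (Site.proj j j x₁) y)))
    (μ ν : Fin P.d) {x₁ x₂ : Site P 0} (hne : x₁ ≠ x₂) (hnear : T P 0 x₁ x₂ ≤ (P.L : ℝ) ^ j) (x' : Site P 0) :
    (P.eps ^ P.d)⁻¹ * |mixedT P P.eps μ ν (pieceT P a msq k j) x₂ x' - mixedT P P.eps μ ν (pieceT P a msq k j) x₁ x'|
        / (P.eps * T P 0 x₁ x₂) ^ α
      ≤ a ^ 2 * (C ^ 3 * B4Sect5Proof.latticeConst P.d (δ / 2) ^ 2 * Real.exp δ)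
          * ((P.spacing j ^ P.d)⁻¹ * (P.spacing j ^ α)⁻¹)
          * Real.exp (-(δ / 2 * (T P 0 x₁ x' / (P.L : ℝ) ^ j))) := by
  have hε := P.eps_pos
  have hεd : 0 < (P.eps ^ P.d)⁻¹ := by positivity
  have hs := P.spacing_pos j
  have hLj : 0 < (P.L : ℝ) ^ j := pow_pos P.cast_L_pos j
  have hsα : 0 < P.spacing j ^ α := Real.rpow_pos_of_pos hs α
  rcases Nat.lt_or_ge j k with hjk | hkj
  · -- `1 ≤ j < k`: the term of (2.34), `K1_j` on both ends
    have hj : j ≤ P.m + P.K := hjk.le.trans hkm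
    have hT1 : 1 ≤ T P 0 x₁ x₂ := one_le_T_of_ne' hne
    have hT0 : 0 < T P 0 x₁ x₂ := by linarith
    set w := ((P.L : ℝ) ^ j / T P 0 x₁ x₂) ^ α with hw
    have hw0 : 0 ≤ w := Real.rpow_nonneg (div_nonneg hLj.le hT0.le) α
    set S := ∑ y : Site P j, ∑ y' : Site P j,
      (K1 P a msq j μ x₂ ⟨j, y⟩ - K1 P a msq j μ x₁ ⟨j, y⟩) * Crs P a msq j y y' * K1 P a msq j ν x' ⟨j, y'⟩ with hS
    -- the weighted sum is the convolution of the weighted (2.36) row with (2.37) and (2.35)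
    have hwS : w * |S| = |∑ y : Site P j, ∑ y' : Site P j,
        (w * (K1 P a msq j μ x₂ ⟨j, y⟩ - K1 P a msq j μ x₁ ⟨j, y⟩)) * Crs P a msq j y y' *
          K1 P a msq j ν x' ⟨j, y'⟩| := by
      calc w * |S| = |w| * |S| := by rw [abs_of_nonneg hw0]
        _ = |w * S| := (abs_mul w S).symm
        _ = _ := by
            congr 1
            rw [hS, Finset.mul_sum]
            refine Finset.sum_congr rfl fun y _ => ?_
            rw [Finset.mul_sum]
            refine Finset.sum_congr rfl fun y' _ => ?_
            ring
    have hconv : w * |S| ≤ C ^ 3 * B4Sect5Proof.latticeConst P.d (δ / 2) ^ 2 *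
        (Real.exp δ * Real.exp (-(δ / 2 * T P 0 x₁ x' / (P.L : ℝ) ^ j))) := by
      rw [hwS]
      have h := conv_bound P hδ hC hC hC (Site.proj j j x₁) (Site.proj j j x')
        (fun y => w * (K1 P a msq j μ x₂ ⟨j, y⟩ - K1 P a msq j μ x₁ ⟨j, y⟩)) (Crs P a msq j)
        (fun y' => K1 P a msq j ν x' ⟨j, y'⟩) (fun y => by
          show |w * (K1 P a msq j μ x₂ ⟨j, y⟩ - K1 P a msq j μ x₁ ⟨j, y⟩)| ≤ _
          rw [abs_mul, abs_of_nonneg hw0]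
          exact hH hjk μ x₁ x₂ (Ne.symm hne) hnear y) (hK.crs j hj1 hjk) (hK.k1 j hj1 hjk ν x')
      have hblk := exp_block_le P hj (show 0 ≤ δ / 2 by positivity) x₁ x'
      rw [show 2 * (δ / 2) = δ from by ring] at hblk
      calc |∑ y : Site P j, ∑ y' : Site P j, (w * (K1 P a msq j μ x₂ ⟨j, y⟩ - K1 P a msq j μ x₁ ⟨j, y⟩)) *
            Crs P a msq j y y' * K1 P a msq j ν x' ⟨j, y'⟩|
          ≤ C * C * C * B4Sect5Proof.latticeConst P.d (δ / 2) ^ 2 *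
              Real.exp (-(δ / 2 * T P j (Site.proj j j x₁) (Site.proj j j x'))) := h
        _ ≤ C * C * C * B4Sect5Proof.latticeConst P.d (δ / 2) ^ 2 *
              (Real.exp δ * Real.exp (-(δ / 2 * T P 0 x₁ x' / (P.L : ℝ) ^ j))) :=
            mul_le_mul_of_nonneg_left hblk (by positivity)
        _ = _ := by ring
    have haj : B1.aSeq a P.L j ^ 2 ≤ a ^ 2 :=
      pow_le_pow_left₀ (B1.aSeq_pos ha (one_lt_cast_L P) hj1).le (B1.aSeq_le ha (one_lt_cast_L P) j hj1) 2
    have hinv : ((P.eps * T P 0 x₁ x₂) ^ α)⁻¹ = (P.spacing j ^ α)⁻¹ * w := by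
      have hmul : (P.eps * T P 0 x₁ x₂) ^ α * w = P.spacing j ^ α := by
        rw [hw, ← Real.mul_rpow (mul_nonneg hε.le hT0.le) (div_nonneg hLj.le hT0.le)]
        congr 1
        unfold Params.spacing
        field_simp
      have hwpos : 0 < w := Real.rpow_pos_of_pos (div_pos hLj hT0) α
      rw [← hmul, mul_inv, mul_assoc, inv_mul_cancel₀ hwpos.ne', mul_one]
    rw [pieceT_of_pos hj1 hjk, mixedT_term_sub_apply ha hm hj1 hj μ ν x₁ x₂ x', ← hS, div_eq_mul_inv, hinv, abs_mul,
      abs_of_nonneg (by positivity)]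
    have hw' : 0 ≤ (((P.L : ℝ) ^ j) ^ P.d)⁻¹ := by positivity
    calc (P.eps ^ P.d)⁻¹ * (B1.aSeq a P.L j ^ 2 * (((P.L : ℝ) ^ j) ^ P.d)⁻¹ * |S|) * ((P.spacing j ^ α)⁻¹ * w)
        = B1.aSeq a P.L j ^ 2 * ((P.eps ^ P.d)⁻¹ * (((P.L : ℝ) ^ j) ^ P.d)⁻¹ * (P.spacing j ^ α)⁻¹) * (w * |S|) := by ring
      _ ≤ a ^ 2 * ((P.eps ^ P.d)⁻¹ * (((P.L : ℝ) ^ j) ^ P.d)⁻¹ * (P.spacing j ^ α)⁻¹) *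
            (C ^ 3 * B4Sect5Proof.latticeConst P.d (δ / 2) ^ 2 *
              (Real.exp δ * Real.exp (-(δ / 2 * T P 0 x₁ x' / (P.L : ℝ) ^ j)))) := by
          refine mul_le_mul (mul_le_mul_of_nonneg_right haj (by positivity)) hconv (mul_nonneg hw0 (abs_nonneg _))
            (by positivity)
      _ = a ^ 2 * (C ^ 3 * B4Sect5Proof.latticeConst P.d (δ / 2) ^ 2 * Real.exp δ) *
            (((P.eps ^ P.d)⁻¹ * (((P.L : ℝ) ^ j) ^ P.d)⁻¹) * (P.spacing j ^ α)⁻¹) *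
            Real.exp (-(δ / 2 * T P 0 x₁ x' / (P.L : ℝ) ^ j)) := by ring
      _ = _ := by rw [eps_weight_zero', mul_div_assoc]
  · -- `j ≥ k`: no piece
    rw [pieceT_of_le hj1 hkj]
    simp only [B3Ineq210MixedTorus.mixedT, Matrix.zero_mul, Matrix.zero_apply, sub_self, abs_zero, mul_zero, zero_div]
    positivity

/-- kernel: for a NEAR pair (`|x₁−x₂|_T ≤ L^j`) the pair-to-point distance of (2.36) dominates the block distance:
`min(d_{XU}(x₁,(j,y)), d_{XU}(x₂,(j,y))) ≥ |proj x₁ − y|_{T^{(j)}} − 2`. [folklore] -/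
private theorem min_dXU_ge' {j : ℕ} (hj : j ≤ P.m + P.K) {x₁ x₂ : Site P 0} (hnear : T P 0 x₁ x₂ ≤ (P.L : ℝ) ^ j)
    (y : Site P j) :
    T P j (Site.proj j j x₁) y - 2 ≤ min (dXU P j x₁ ⟨j, y⟩) (dXU P j x₂ ⟨j, y⟩) := by
  have hLj : 0 < (P.L : ℝ) ^ j := pow_pos P.cast_L_pos j
  have h1 := T_proj_le_dXU_add_one P hj x₁ y
  refine le_min (by linarith) ?_
  have hu : 0 < ((P.L : ℝ) ^ j)⁻¹ := inv_pos.2 hLj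
  have huL : ((P.L : ℝ) ^ j)⁻¹ * (P.L : ℝ) ^ j = 1 := inv_mul_cancel₀ hLj.ne'
  have t := mul_le_mul_of_nonneg_left (T_triangle P 0 x₁ x₂ (fineU P ⟨j, y⟩)) hu.le
  have hn := mul_le_mul_of_nonneg_left hnear hu.le
  have e1 : dXU P j x₁ ⟨j, y⟩ = ((P.L : ℝ) ^ j)⁻¹ * T P 0 x₁ (fineU P ⟨j, y⟩) := rfl
  have e2 : dXU P j x₂ ⟨j, y⟩ = ((P.L : ℝ) ^ j)⁻¹ * T P 0 x₂ (fineU P ⟨j, y⟩) := rfl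
  rw [e1] at h1
  rw [e2]
  linarith

/-- kernel: the kernel inputs are monotone in their constants. [folklore] -/
private theorem kerBounds_mono' {k : ℕ} {C C' δ δ' : ℝ} (hC : 0 ≤ C) (hCC : C ≤ C') (hδδ : δ' ≤ δ)
    (h : KerBounds P a msq k C δ) : KerBounds P a msq k C' δ' :=
  ⟨fun j hj1 hjk x y => decay_mono (T_nonneg P j _ _) hCC hC hδδ (h.gq j hj1 hjk x y),
    fun j hj1 hjk y y' => decay_mono (T_nonneg P j _ _) hCC hC hδδ (h.crs j hj1 hjk y y'),
    fun j hj1 hjk μ x y => decay_mono (T_nonneg P j _ _) hCC hC hδδ (h.k1 j hj1 hjk μ x y)⟩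

/-- kernel: the torus (2.36) input in the pair-to-point form of `holder236_torus` gives the block form consumed by
`mixedHolderNear_le_of`, at the widened constants `(max C (c₁e^{2δ_H}), min δ δ_H)`. [folklore] -/
private theorem near_block_form' {j : ℕ} (hj : j ≤ P.m + P.K) {α c₁ δH : ℝ} (C δ : ℝ) (hc₁ : 0 ≤ c₁) (hδH : 0 < δH)
    (hH : ∀ (μ : Fin P.d) (x x' : Site P 0), x' ≠ x → ∀ y : Site P j,
      ((P.L : ℝ) ^ j / T P 0 x x') ^ α * |K1 P a msq j μ x' ⟨j, y⟩ - K1 P a msq j μ x ⟨j, y⟩|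
        ≤ c₁ * Real.exp (-(δH * min (dXU P j x ⟨j, y⟩) (dXU P j x' ⟨j, y⟩))))
    (μ : Fin P.d) (x₁ x₂ : Site P 0) (hne : x₂ ≠ x₁) (hnear : T P 0 x₁ x₂ ≤ (P.L : ℝ) ^ j) (y : Site P j) :
    ((P.L : ℝ) ^ j / T P 0 x₁ x₂) ^ α * |K1 P a msq j μ x₂ ⟨j, y⟩ - K1 P a msq j μ x₁ ⟨j, y⟩|
      ≤ max C (c₁ * Real.exp (2 * δH)) * Real.exp (-(min δ δH * T P j (Site.proj j j x₁) y)) := by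
  have h := hH μ x₁ x₂ hne y
  have hmin := min_dXU_ge' hj hnear y
  have h' : ((P.L : ℝ) ^ j / T P 0 x₁ x₂) ^ α * |K1 P a msq j μ x₂ ⟨j, y⟩ - K1 P a msq j μ x₁ ⟨j, y⟩|
      ≤ c₁ * Real.exp (2 * δH) * Real.exp (-(δH * T P j (Site.proj j j x₁) y)) := by
    refine h.trans ?_
    rw [mul_assoc, ← Real.exp_add]
    exact mul_le_mul_of_nonneg_left (Real.exp_le_exp.2 (by nlinarith [mul_le_mul_of_nonneg_left hmin hδH.le])) hc₁
  exact decay_mono (T_nonneg P j _ _) (le_max_right _ _) (by positivity) (min_le_right _ _) h'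

/-- **B3 (2.11)/(2.10) p. 426 — THE HÖLDER LAW OF THE TWICE-DIFFERENTIATED PIECES IN THE ROW VARIABLE, PROVED FOR THE TORUS MODEL
INSTANCE `A = B̃ = 0`, `Ω = T_η`, AT EVERY FIXED HÖLDER EXPONENT, hypothesis-free and uniform in the volume and the scale**: for `d ≥ 1`,
odd `L > 1`, `a > 0`, `m² ≥ 0` and `0 ≤ α < 1` there are `δ₁ > 0`, `C > 0` (functions of `d, L, a, m², α`) such that for EVERY volume
`P = (d, L, m, K)` of Bałaban's scalar torus tower, every scale `1 ≤ k ≤ K`, all `j`, `μ, ν`, `x₁ ≠ x₂`, `x′`: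
`η^{−d}|(∂^η_μG^η_{(j)}∂^{η*}_ν)(x₂,x′) − (∂^η_μG^η_{(j)}∂^{η*}_ν)(x₁,x′)|/(η|x₁−x₂|_T)^α ≤ C((L^jη)^d)^{−1}((L^jη)^α)^{−1}·
e^{−δ₁(L^jη)^{−1}·η·min(|x₁−x′|_T,|x₂−x′|_T)}` — print's *"for each differentiation … an additional factor (L^jη)^{−1} … This applies also to
Hölder norms"* read for the twice-differentiated kernel (one factor `(L^jη)^{−1}` off the (2.11) display).  Route = p03's for (2.11) with
the third kernel `K1_j(ν;x′,·)` of (2.35) (p20's `mixedT_term_apply`): near pairs by [7] Lemma 2.4 (2.36) on the torus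
(`B4Lemma24TorusScales.holder236_torus`), far pairs by the triangle inequality, the `j = 0` piece always far.
[cite: Balaban1983Higgs3, (2.10)–(2.11) p.426] -/
theorem ineq211_mixed_zeroTorus (d L : ℕ) (hd : 1 ≤ d) (hL : Odd L ∧ 1 < L) {a : ℝ} (ha : 0 < a) {msq : ℝ}
    (hmsq : 0 ≤ msq) {α : ℝ} (hα0 : 0 ≤ α) (hα1 : α < 1) :
    ∃ δ₁ C : ℝ, 0 < δ₁ ∧ 0 < C ∧ ∀ (P : Params), P.d = d → P.L = L →
      ∀ k : ℕ, 1 ≤ k → k ≤ P.K → ∀ (j : ℕ) (μ ν : Fin P.d) (x₁ x₂ x' : Site P 0), x₁ ≠ x₂ →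
        (P.eps ^ P.d)⁻¹ * |mixedT P P.eps μ ν (pieceT P a msq k j) x₂ x' - mixedT P P.eps μ ν (pieceT P a msq k j) x₁ x'|
            / (P.eps * T P 0 x₁ x₂) ^ α
          ≤ C * ((P.spacing j ^ P.d)⁻¹ * (P.spacing j ^ α)⁻¹) *
              Real.exp (-(δ₁ * (P.spacing j)⁻¹ * (P.eps * min (T P 0 x₁ x') (T P 0 x₂ x')))) := by
  obtain ⟨C, δ, hC, hδ, hK⟩ := kerBounds_torus d L hd hL ha msq
  obtain ⟨δH, hδH, hHall⟩ := holder236_torus d L hd hL ha msq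
  obtain ⟨c₁, hc₁, hH⟩ := hHall hα0 hα1
  -- the `j = 0` constants depend on `d, L, a, m²` only; read them off any volume with these `d, L`
  obtain ⟨P₀, hP₀d, hP₀L⟩ : ∃ P₀ : Params, P₀.d = d ∧ P₀.L = L := ⟨⟨d, L, 0, 0, hd, hL⟩, rfl, rfl⟩
  set C₀ := 2 / gamma0 L a with hC₀def
  set δ₀ := dK0 d L a msq with hδ₀def
  have hC₀ : 0 ≤ C₀ := by
    rw [hC₀def, ← hP₀L]; exact (div_pos two_pos (gamma0_pos (P := P₀) ha)).le
  have hδ₀ : 0 < δ₀ := by rw [hδ₀def, ← hP₀d, ← hP₀L]; exact dK0_pos (P := P₀) ha hmsq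
  -- widened common constants for (2.35)/(2.37) and the block form of (2.36)
  set C' := max C (c₁ * Real.exp (2 * δH))
  set δ' := min δ δH
  have hC' : 0 ≤ C' := hC.trans (le_max_left _ _)
  have hδ' : 0 < δ' := lt_min hδ hδH
  have hCd0 : 0 ≤ 4 * C₀ * Real.exp (2 * δ₀) + a ^ 2 * (C' ^ 3 * B4Sect5Proof.latticeConst d (δ' / 2) ^ 2 * Real.exp δ') := by
    positivity
  have hCn0 : 0 ≤ a ^ 2 * (C' ^ 3 * B4Sect5Proof.latticeConst d (δ' / 2) ^ 2 * Real.exp δ') := by positivity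
  set Cd := 4 * C₀ * Real.exp (2 * δ₀) + a ^ 2 * (C' ^ 3 * B4Sect5Proof.latticeConst d (δ' / 2) ^ 2 * Real.exp δ') with hCd
  set Cn := a ^ 2 * (C' ^ 3 * B4Sect5Proof.latticeConst d (δ' / 2) ^ 2 * Real.exp δ') with hCn
  refine ⟨min δ₀ (δ' / 2), 2 * Cd + Cn + 1, lt_min hδ₀ (by positivity), by positivity, ?_⟩
  intro P hPd hPL k hk1 hkK j μ ν x₁ x₂ x' hne
  have hkm : k ≤ P.m + P.K := hkK.trans (Nat.le_add_left _ _)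
  have hcapk : ∀ j, j ≤ P.K → P.spacing j ^ 2 * msq ≤ msq := by
    intro j hjK
    have hs1 : P.spacing j ≤ 1 := by rw [← P.spacing_K]; exact spacing_le_spacing P hjK
    have hs0 := (P.spacing_pos j).le
    calc P.spacing j ^ 2 * msq ≤ 1 * msq := mul_le_mul_of_nonneg_right (pow_le_one₀ hs0 hs1) hmsq
      _ = msq := one_mul _
  have hKB : KerBounds P a msq k C' δ' :=
    kerBounds_mono' hC (le_max_left _ _) (min_le_left _ _) (hK P hPd hPL msq hmsq k hkm (hcapk k hkK))
  have hHB : ∀ j, 1 ≤ j → j < k → ∀ (μ : Fin P.d) (x₁ x₂ : Site P 0), x₂ ≠ x₁ → T P 0 x₁ x₂ ≤ (P.L : ℝ) ^ j →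
      ∀ y : Site P j, ((P.L : ℝ) ^ j / T P 0 x₁ x₂) ^ α * |K1 P a msq j μ x₂ ⟨j, y⟩ - K1 P a msq j μ x₁ ⟨j, y⟩|
        ≤ C' * Real.exp (-(δ' * T P j (Site.proj j j x₁) y)) := by
    intro j hj1 hjk μ x₁ x₂ hne hnear y
    have hjm : j ≤ P.m + P.K := hjk.le.trans hkm
    exact near_block_form' hjm C δ hc₁.le hδH (fun μ x x' hne' y' => hH P hPd hPL msq hmsq j hj1 hjm
      (hcapk j (hjk.le.trans hkK)) μ x x' hne' y') μ x₁ x₂ hne hnear y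
  subst hPd hPL
  have hG0 : ∀ x x' : Site P 0, |G0unit P a msq x x'| ≤ C₀ * Real.exp (-(δ₀ * T P 0 x x')) :=
    fun x x' => G0unit_decay (P := P) ha hmsq x x'
  have hs := P.spacing_pos j
  have hLj : 0 < (P.L : ℝ) ^ j := pow_pos P.cast_L_pos j
  have hW : 0 ≤ (P.spacing j ^ P.d)⁻¹ * (P.spacing j ^ α)⁻¹ := by
    have := Real.rpow_pos_of_pos hs α; positivity
  rw [mul_assoc (min δ₀ (δ' / 2)) ((P.spacing j)⁻¹), scale_inv_mul']
  rcases le_or_gt ((P.L : ℝ) ^ j) (T P 0 x₁ x₂) with hfar | hlt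
  · -- far pairs (every `j`; the `j = 0` piece always lands here)
    refine (mixedHolderFar_le_of ha hmsq hkm hC' hδ' hC₀ hδ₀ hKB hG0 hα0 j μ ν hfar x').trans ?_
    exact mul_le_mul_of_nonneg_right (mul_le_mul_of_nonneg_right (by linarith) hW) (Real.exp_pos _).le
  · -- near pairs: `|x₁−x₂|_T < L^j` forces `j ≥ 1`
    have hj1 : 1 ≤ j := by
      rcases Nat.eq_zero_or_pos j with h0 | hpos
      · subst h0
        have h1 := one_le_T_of_ne' hne
        simp only [pow_zero] at hlt; linarith
      · exact hpos
    have hE : Real.exp (-(δ' / 2 * (T P 0 x₁ x' / (P.L : ℝ) ^ j)))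
        ≤ Real.exp (-(min δ₀ (δ' / 2) * (min (T P 0 x₁ x') (T P 0 x₂ x') / (P.L : ℝ) ^ j))) := by
      refine Real.exp_le_exp.2 (neg_le_neg ?_)
      have hq : 0 ≤ min (T P 0 x₁ x') (T P 0 x₂ x') / (P.L : ℝ) ^ j :=
        div_nonneg (le_min (T_nonneg P 0 _ _) (T_nonneg P 0 _ _)) hLj.le
      have hq' : min (T P 0 x₁ x') (T P 0 x₂ x') / (P.L : ℝ) ^ j ≤ T P 0 x₁ x' / (P.L : ℝ) ^ j :=
        div_le_div_of_nonneg_right (min_le_left _ _) hLj.le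
      calc min δ₀ (δ' / 2) * (min (T P 0 x₁ x') (T P 0 x₂ x') / (P.L : ℝ) ^ j)
          ≤ δ' / 2 * (min (T P 0 x₁ x') (T P 0 x₂ x') / (P.L : ℝ) ^ j) :=
            mul_le_mul_of_nonneg_right (min_le_right _ _) hq
        _ ≤ δ' / 2 * (T P 0 x₁ x' / (P.L : ℝ) ^ j) := mul_le_mul_of_nonneg_left hq' (by positivity)
    refine (mixedHolderNear_le_of ha hmsq hkm hC' hδ' hKB hj1 (fun hjk => hHB j hj1 hjk) μ ν hne hlt.le x').trans ?_
    calc Cn * ((P.spacing j ^ P.d)⁻¹ * (P.spacing j ^ α)⁻¹) * Real.exp (-(δ' / 2 * (T P 0 x₁ x' / (P.L : ℝ) ^ j)))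
        ≤ Cn * ((P.spacing j ^ P.d)⁻¹ * (P.spacing j ^ α)⁻¹) *
          Real.exp (-(min δ₀ (δ' / 2) * (min (T P 0 x₁ x') (T P 0 x₂ x') / (P.L : ℝ) ^ j))) :=
          mul_le_mul_of_nonneg_left hE (mul_nonneg hCn0 hW)
      _ ≤ _ := by
          exact mul_le_mul_of_nonneg_right (mul_le_mul_of_nonneg_right (by linarith) hW) (Real.exp_pos _).le

end MixedHolder

/-! ## §3 The Hölder laws of the flat torus block propagator kernel, summed over the scales -/

section Summed

variable {P : Params}

/-- kernel: r15's once-differentiated kernel of the `η^{−d}`-normalised piece is the `η^{−d}`-normalised left derivative of the piece.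
[folklore] -/
private theorem d1Kernel_gpiece {a msq : ℝ} (k j : ℕ) (μ : Fin P.d) (x z : Site P 0) :
    d1Kernel P.eps⁻¹ μ (gpiece P a msq k j) x z = (P.eps ^ P.d)⁻¹ * (deriv P 0 P.eps μ * pieceT P a msq k j) x z := by
  rw [B5Leaf235Torus.deriv_mul_apply]
  simp only [d1Kernel, gpiece]
  ring

/-- kernel: r15's twice-differentiated kernel of the `η^{−d}`-normalised piece is the `η^{−d}`-normalised `mixedT` of the piece.
[folklore] -/
private theorem d2Kernel_gpiece {a msq : ℝ} (k j : ℕ) (μ ν : Fin P.d) (x z : Site P 0) :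
    d2Kernel P.eps⁻¹ μ ν (gpiece P a msq k j) x z = (P.eps ^ P.d)⁻¹ * mixedT P P.eps μ ν (pieceT P a msq k j) x z := by
  rw [mixedT_apply]
  simp only [d2Kernel, gpiece]
  ring

/-- kernel: the row Hölder difference of the once-differentiated propagator as a sum over the scales.
[cite: Balaban1983Higgs3, (2.6) p.424] -/
private theorem holderDiff₁_eq_sum {a msq : ℝ} (ha : 0 < a) (hm : 0 ≤ msq) {k : ℕ} (hk : 1 ≤ k) (μ : Fin P.d)
    (x₁ x₂ z : Site P 0) :
    ((tower P a msq).G k (x₂.shift μ) z - (tower P a msq).G k x₂ z)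
        - ((tower P a msq).G k (x₁.shift μ) z - (tower P a msq).G k x₁ z) =
      P.eps ^ (P.d + 1) * ∑ j ∈ range k, (P.eps ^ P.d)⁻¹ *
        ((deriv P 0 P.eps μ * pieceT P a msq k j) x₂ z - (deriv P 0 P.eps μ * pieceT P a msq k j) x₁ z) := by
  rw [diff₁_eq_sum_pieces ha hm hk μ x₂ z, diff₁_eq_sum_pieces ha hm hk μ x₁ z, ← mul_sub, ← Finset.sum_sub_distrib]
  congr 1
  refine Finset.sum_congr rfl fun j _ => ?_
  rw [d1Kernel_gpiece, d1Kernel_gpiece]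
  ring

/-- kernel: the row Hölder difference of the twice-differentiated propagator as a sum over the scales.
[cite: Balaban1983Higgs3, (2.6) p.424] -/
private theorem holderDiff₂_eq_sum {a msq : ℝ} (ha : 0 < a) (hm : 0 ≤ msq) {k : ℕ} (hk : 1 ≤ k) (μ ν : Fin P.d)
    (x₁ x₂ z : Site P 0) :
    ((tower P a msq).G k (x₂.shift μ) (z.shift ν) - (tower P a msq).G k (x₂.shift μ) z
          - (tower P a msq).G k x₂ (z.shift ν) + (tower P a msq).G k x₂ z)
        - ((tower P a msq).G k (x₁.shift μ) (z.shift ν) - (tower P a msq).G k (x₁.shift μ) z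
          - (tower P a msq).G k x₁ (z.shift ν) + (tower P a msq).G k x₁ z) =
      P.eps ^ (P.d + 2) * ∑ j ∈ range k, (P.eps ^ P.d)⁻¹ *
        (mixedT P P.eps μ ν (pieceT P a msq k j) x₂ z - mixedT P P.eps μ ν (pieceT P a msq k j) x₁ z) := by
  rw [diff₂_eq_sum_pieces ha hm hk μ ν x₂ z, diff₂_eq_sum_pieces ha hm hk μ ν x₁ z, ← mul_sub, ← Finset.sum_sub_distrib]
  congr 1
  refine Finset.sum_congr rfl fun j _ => ?_
  rw [d2Kernel_gpiece, d2Kernel_gpiece]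
  ring

/-- kernel: the scale factor of (2.11) — `(L^jε)^{1−d−α} = ε^{1−d−α}·((L^j)⁻¹)^{d−1+α}`. [folklore] -/
private theorem spacing_rpow_one_sub (j : ℕ) (α : ℝ) :
    P.spacing j ^ ((1 : ℝ) - (P.d : ℝ) - α) = P.eps ^ ((1 : ℝ) - (P.d : ℝ) - α) * (((P.L : ℝ) ^ j)⁻¹) ^ ((P.d : ℝ) - 1 + α) := by
  have hL : 0 < (P.L : ℝ) ^ j := pow_pos P.cast_L_pos j
  have hε := P.eps_pos
  unfold Params.spacing
  rw [Real.mul_rpow hL.le hε.le, Real.inv_rpow hL.le, ← Real.rpow_neg hL.le, mul_comm]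
  congr 1
  congr 1
  ring

/-- kernel: the scale factor of the mixed Hölder law — `((L^jε)^d)^{−1}((L^jε)^α)^{−1} = ε^{−(d+α)}·((L^j)⁻¹)^{d+α}`. [folklore] -/
private theorem spacing_pow_inv_mul (j : ℕ) (α : ℝ) :
    (P.spacing j ^ P.d)⁻¹ * (P.spacing j ^ α)⁻¹ =
      P.eps ^ (-((P.d : ℝ) + α)) * (((P.L : ℝ) ^ j)⁻¹) ^ ((P.d : ℝ) + α) := by
  have hL : 0 < (P.L : ℝ) ^ j := pow_pos P.cast_L_pos j
  have hε := P.eps_pos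
  have hs := P.spacing_pos j
  rw [← Real.rpow_natCast (P.spacing j) P.d, ← mul_inv, ← Real.rpow_add hs, ← Real.rpow_neg hs.le]
  unfold Params.spacing
  rw [Real.mul_rpow hL.le hε.le, Real.inv_rpow hL.le, ← Real.rpow_neg hL.le, mul_comm]

/-- kernel: the `ε`-powers of the first Hölder law collapse to `ε²`: `ε^{d+1}·(ε^α·ε^{1−d−α}) = ε²`. [folklore] -/
private theorem eps_collapse₁ (α : ℝ) :
    P.eps ^ (P.d + 1) * (P.eps ^ α * P.eps ^ ((1 : ℝ) - (P.d : ℝ) - α)) = P.eps ^ 2 := by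
  have hε := P.eps_pos
  rw [← Real.rpow_add hε, ← Real.rpow_natCast P.eps (P.d + 1), ← Real.rpow_add hε, ← Real.rpow_natCast P.eps 2]
  congr 1
  push_cast
  ring

/-- kernel: the `ε`-powers of the mixed Hölder law collapse to `ε²`: `ε^{d+2}·(ε^α·ε^{−(d+α)}) = ε²`. [folklore] -/
private theorem eps_collapse₂ (α : ℝ) :
    P.eps ^ (P.d + 2) * (P.eps ^ α * P.eps ^ (-((P.d : ℝ) + α))) = P.eps ^ 2 := by
  have hε := P.eps_pos
  rw [← Real.rpow_add hε, ← Real.rpow_natCast P.eps (P.d + 2), ← Real.rpow_add hε, ← Real.rpow_natCast P.eps 2]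
  congr 1
  push_cast
  ring

/-- kernel: the distance from the pair in lattice units — `η·min(|x₁−z|_T,|x₂−z|_T)·(L^jη)^{−1} = min(|x₁−z|_∞,|x₂−z|_∞)/L^j` with
r15's `supDist`. [folklore] -/
private theorem pair_dist_eq (j : ℕ) (x₁ x₂ z : Site P 0) :
    (P.spacing j)⁻¹ * (P.eps * min (T P 0 x₁ z) (T P 0 x₂ z)) =
      ((min (supDist x₁ z) (supDist x₂ z) : ℕ) : ℝ) / (P.L : ℝ) ^ j := by
  rw [scale_inv_mul', T_eq_supDist, T_eq_supDist, Nat.cast_min]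

/-- **THE HÖLDER LAWS, IN THE ROW VARIABLE, OF THE FLAT TORUS BLOCK PROPAGATOR KERNEL** `G_k(T_ε,0) = (−Δ^ε + m² +
a_k(L^kε)^{−2}Q_k^*Q_k)^{−1}` (Bałaban's scalar torus tower `B1RG242Torus.tower`, matrix entries in the counting-measure normalisation):
for `d ≥ 2`, odd `L > 1`, `a > 0`, `m² ≥ 0` and `0 ≤ α < 1` there is `C > 0` (a function of `d, L, a, m², α`) such that for EVERY volume
`P` (`P.d = d`, `P.L = L`), every `1 ≤ k ≤ K`, all directions and all sites `x₁, x₂, z`, with `ρ = |x₁−x₂|_∞` and `R =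
min(|x₁−z|_∞, |x₂−z|_∞)`:
`|(G(x₂+e_μ,z) − G(x₂,z)) − (G(x₁+e_μ,z) − G(x₁,z))| ≤ Cε²ρ^α·max(R,1)^{−(d−1+α)}` and
`|Δ_{x₁→x₂}[G(x+e_μ,z+e_ν) − G(x+e_μ,z) − G(x,z+e_ν) + G(x,z)]| ≤ Cε²ρ^α·max(R,1)^{−(d+α)}` — the *"corresponding inequalities for
derivatives"* of [Balaban1983Higgs3] p. 437 in their Hölder form, for one difference in the row variable and for one difference in each
variable, by summing the per-piece Hölder bounds (p03's (2.11) `ineq211At_zeroTorusH`; §2 `ineq211_mixed_zeroTorus`) over the scales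
with §1; the near-diagonal laws `R^{−(d−1+α)}`, `R^{−(d+α)}` are what the sum over the scales produces.  These are the far-zone kernel
inputs of the interior Hölder estimate of the companion file `BIJ85ScalarPropagatorSupDecayHolder` ([BalabanImbrieJaffe1985] p. 326, the
Hölder member of [7] (1.9)).  At `x₁ = x₂` both sides vanish or the right side is nonnegative.
[cite: Balaban1983Higgs3, (2.10)–(2.11) p.426, p.437; BalabanImbrieJaffe1985, (7.3.2) p.326] -/
theorem flat_kernel_holder (d L : ℕ) (hd : 2 ≤ d) (hL : Odd L ∧ 1 < L) {a : ℝ} (ha : 0 < a) {msq : ℝ} (hmsq : 0 ≤ msq)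
    {α : ℝ} (hα0 : 0 ≤ α) (hα1 : α < 1) :
    ∃ C : ℝ, 0 < C ∧ ∀ (P : Params), P.d = d → P.L = L → ∀ k : ℕ, 1 ≤ k → k ≤ P.K →
      (∀ (μ : Fin P.d) (x₁ x₂ z : Site P 0),
        |((tower P a msq).G k (x₂.shift μ) z - (tower P a msq).G k x₂ z)
            - ((tower P a msq).G k (x₁.shift μ) z - (tower P a msq).G k x₁ z)| ≤
          C * P.eps ^ 2 * (supDist x₁ x₂ : ℝ) ^ α /
            (max ((min (supDist x₁ z) (supDist x₂ z) : ℕ) : ℝ) 1) ^ ((d : ℝ) - 1 + α)) ∧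
      (∀ (μ ν : Fin P.d) (x₁ x₂ z : Site P 0),
        |((tower P a msq).G k (x₂.shift μ) (z.shift ν) - (tower P a msq).G k (x₂.shift μ) z
              - (tower P a msq).G k x₂ (z.shift ν) + (tower P a msq).G k x₂ z)
            - ((tower P a msq).G k (x₁.shift μ) (z.shift ν) - (tower P a msq).G k (x₁.shift μ) z
              - (tower P a msq).G k x₁ (z.shift ν) + (tower P a msq).G k x₁ z)| ≤
          C * P.eps ^ 2 * (supDist x₁ x₂ : ℝ) ^ α /
            (max ((min (supDist x₁ z) (supDist x₂ z) : ℕ) : ℝ) 1) ^ ((d : ℝ) + α)) := by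
  have hd1 : 1 ≤ d := by omega
  obtain ⟨δ₁, C₁, hδ₁, hC₁, h211⟩ := ineq211At_zeroTorusH d L hd1 hL ha hmsq hα0 hα1
  obtain ⟨δ₂, C₂, hδ₂, hC₂, hmix⟩ := ineq211_mixed_zeroTorus d L hd1 hL ha hmsq hα0 hα1
  have hL1 : (1 : ℝ) < L := by exact_mod_cast hL.2
  have hdR : (2 : ℝ) ≤ d := by exact_mod_cast hd
  obtain ⟨S₁, hS₁, hS₁b⟩ := scaleSum_rpow_le_max hL1 hδ₁ (p := (d : ℝ) - 1 + α) (by linarith)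
  obtain ⟨S₂, hS₂, hS₂b⟩ := scaleSum_rpow_le_max hL1 hδ₂ (p := (d : ℝ) + α) (by linarith)
  refine ⟨C₁ * S₁ + C₂ * S₂, by positivity, ?_⟩
  intro P hPd hPL k hk1 hkK
  have h211P := h211 P hPd hPL k hk1 hkK
  have hmixP := hmix P hPd hPL k hk1 hkK
  subst hPd; subst hPL
  have hε : 0 < P.eps := P.eps_pos
  -- the sum over the scales against the sup distance from the pair
  have hsum : ∀ {p S δ : ℝ}, 0 < S →
      (∀ k n : ℕ, ∑ j ∈ range k, (((P.L : ℝ) ^ j)⁻¹) ^ p * Real.exp (-(δ * n / (P.L : ℝ) ^ j)) ≤ S / (max (n : ℝ) 1) ^ p) →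
      ∀ (x₁ x₂ z : Site P 0),
        ∑ j ∈ range k, (((P.L : ℝ) ^ j)⁻¹) ^ p *
            Real.exp (-(δ * ((min (supDist x₁ z) (supDist x₂ z) : ℕ) : ℝ) / (P.L : ℝ) ^ j)) ≤
          S / (max ((min (supDist x₁ z) (supDist x₂ z) : ℕ) : ℝ) 1) ^ p :=
    fun hS hSb x₁ x₂ z => hSb k _
  constructor
  · intro μ x₁ x₂ z
    set m : ℕ := min (supDist x₁ z) (supDist x₂ z) with hm
    have hM : 0 < max (m : ℝ) 1 := lt_max_of_lt_right one_pos
    by_cases hne : x₁ = x₂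
    · subst hne
      rw [sub_self, abs_zero]
      positivity
    have hT1 : 1 ≤ T P 0 x₁ x₂ := one_le_T_of_ne' hne
    have hT0 : 0 < T P 0 x₁ x₂ := by linarith
    have hdistα : 0 < (P.eps * T P 0 x₁ x₂) ^ α := Real.rpow_pos_of_pos (mul_pos hε hT0) α
    -- the per-piece Hölder bound (2.11), denominator cleared
    have hpiece : ∀ j : ℕ, (P.eps ^ P.d)⁻¹ *
        |(deriv P 0 P.eps μ * pieceT P a msq k j) x₂ z - (deriv P 0 P.eps μ * pieceT P a msq k j) x₁ z| ≤
          (P.eps * T P 0 x₁ x₂) ^ α * (C₁ * P.spacing j ^ ((1 : ℝ) - (P.d : ℝ) - α) *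
            Real.exp (-(δ₁ * (m : ℝ) / (P.L : ℝ) ^ j))) := by
      intro j
      have h := h211P j μ x₁ x₂ z hne
      have h' : (P.eps ^ P.d)⁻¹ *
          |(deriv P 0 P.eps μ * pieceT P a msq k j) x₂ z - (deriv P 0 P.eps μ * pieceT P a msq k j) x₁ z|
            / (P.eps * T P 0 x₁ x₂) ^ α ≤
          C₁ * P.spacing j ^ ((1 : ℝ) - (P.d : ℝ) - α) *
            Real.exp (-(δ₁ * (P.spacing j)⁻¹ * (P.eps * min (T P 0 x₁ z) (T P 0 x₂ z)))) := h
      rw [mul_assoc δ₁, pair_dist_eq, ← hm, ← mul_div_assoc] at h'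
      rwa [div_le_iff₀ hdistα, mul_comm _ ((P.eps * T P 0 x₁ x₂) ^ α)] at h'
    rw [holderDiff₁_eq_sum ha hmsq hk1 μ x₁ x₂ z, abs_mul, abs_of_pos (pow_pos hε _)]
    have hS := hsum hS₁ hS₁b x₁ x₂ z
    rw [← hm] at hS
    calc P.eps ^ (P.d + 1) * |∑ j ∈ range k, (P.eps ^ P.d)⁻¹ *
          ((deriv P 0 P.eps μ * pieceT P a msq k j) x₂ z - (deriv P 0 P.eps μ * pieceT P a msq k j) x₁ z)|
        ≤ P.eps ^ (P.d + 1) * ∑ j ∈ range k, (P.eps * T P 0 x₁ x₂) ^ α * (C₁ * P.spacing j ^ ((1 : ℝ) - (P.d : ℝ) - α) *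
            Real.exp (-(δ₁ * (m : ℝ) / (P.L : ℝ) ^ j))) := by
          refine mul_le_mul_of_nonneg_left ((abs_sum_le_sum_abs _ _).trans (sum_le_sum fun j _ => ?_)) (by positivity)
          rw [abs_mul, abs_of_pos (by positivity : (0 : ℝ) < (P.eps ^ P.d)⁻¹)]
          exact hpiece j
      _ = P.eps ^ (P.d + 1) * (P.eps ^ α * P.eps ^ ((1 : ℝ) - (P.d : ℝ) - α)) * (T P 0 x₁ x₂ ^ α * C₁) *
            ∑ j ∈ range k, (((P.L : ℝ) ^ j)⁻¹) ^ ((P.d : ℝ) - 1 + α) * Real.exp (-(δ₁ * (m : ℝ) / (P.L : ℝ) ^ j)) := by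
          rw [Finset.mul_sum, Finset.mul_sum]
          refine Finset.sum_congr rfl fun j _ => ?_
          rw [Real.mul_rpow hε.le hT0.le, spacing_rpow_one_sub]
          ring
      _ = P.eps ^ 2 * (T P 0 x₁ x₂ ^ α * C₁) *
            ∑ j ∈ range k, (((P.L : ℝ) ^ j)⁻¹) ^ ((P.d : ℝ) - 1 + α) * Real.exp (-(δ₁ * (m : ℝ) / (P.L : ℝ) ^ j)) := by
          rw [eps_collapse₁]
      _ ≤ P.eps ^ 2 * (T P 0 x₁ x₂ ^ α * C₁) * (S₁ / (max (m : ℝ) 1) ^ ((P.d : ℝ) - 1 + α)) :=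
          mul_le_mul_of_nonneg_left hS (by positivity)
      _ = C₁ * S₁ * P.eps ^ 2 * (supDist x₁ x₂ : ℝ) ^ α / (max (m : ℝ) 1) ^ ((P.d : ℝ) - 1 + α) := by
          rw [T_eq_supDist]; ring
      _ ≤ (C₁ * S₁ + C₂ * S₂) * P.eps ^ 2 * (supDist x₁ x₂ : ℝ) ^ α / (max (m : ℝ) 1) ^ ((P.d : ℝ) - 1 + α) := by
          refine div_le_div_of_nonneg_right ?_ (Real.rpow_nonneg hM.le _)
          refine mul_le_mul_of_nonneg_right (mul_le_mul_of_nonneg_right (by nlinarith) (by positivity)) ?_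
          exact Real.rpow_nonneg (Nat.cast_nonneg _) _
  · intro μ ν x₁ x₂ z
    set m : ℕ := min (supDist x₁ z) (supDist x₂ z) with hm
    have hM : 0 < max (m : ℝ) 1 := lt_max_of_lt_right one_pos
    by_cases hne : x₁ = x₂
    · subst hne
      rw [sub_self, abs_zero]
      positivity
    have hT1 : 1 ≤ T P 0 x₁ x₂ := one_le_T_of_ne' hne
    have hT0 : 0 < T P 0 x₁ x₂ := by linarith
    have hdistα : 0 < (P.eps * T P 0 x₁ x₂) ^ α := Real.rpow_pos_of_pos (mul_pos hε hT0) α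
    have hpiece : ∀ j : ℕ, (P.eps ^ P.d)⁻¹ *
        |mixedT P P.eps μ ν (pieceT P a msq k j) x₂ z - mixedT P P.eps μ ν (pieceT P a msq k j) x₁ z| ≤
          (P.eps * T P 0 x₁ x₂) ^ α * (C₂ * ((P.spacing j ^ P.d)⁻¹ * (P.spacing j ^ α)⁻¹) *
            Real.exp (-(δ₂ * (m : ℝ) / (P.L : ℝ) ^ j))) := by
      intro j
      have h' := hmixP j μ ν x₁ x₂ z hne
      rw [mul_assoc δ₂, pair_dist_eq, ← hm, ← mul_div_assoc] at h'
      rwa [div_le_iff₀ hdistα, mul_comm _ ((P.eps * T P 0 x₁ x₂) ^ α)] at h'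
    rw [holderDiff₂_eq_sum ha hmsq hk1 μ ν x₁ x₂ z, abs_mul, abs_of_pos (pow_pos hε _)]
    have hS := hsum hS₂ hS₂b x₁ x₂ z
    rw [← hm] at hS
    calc P.eps ^ (P.d + 2) * |∑ j ∈ range k, (P.eps ^ P.d)⁻¹ *
          (mixedT P P.eps μ ν (pieceT P a msq k j) x₂ z - mixedT P P.eps μ ν (pieceT P a msq k j) x₁ z)|
        ≤ P.eps ^ (P.d + 2) * ∑ j ∈ range k, (P.eps * T P 0 x₁ x₂) ^ α *
            (C₂ * ((P.spacing j ^ P.d)⁻¹ * (P.spacing j ^ α)⁻¹) * Real.exp (-(δ₂ * (m : ℝ) / (P.L : ℝ) ^ j))) := by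
          refine mul_le_mul_of_nonneg_left ((abs_sum_le_sum_abs _ _).trans (sum_le_sum fun j _ => ?_)) (by positivity)
          rw [abs_mul, abs_of_pos (by positivity : (0 : ℝ) < (P.eps ^ P.d)⁻¹)]
          exact hpiece j
      _ = P.eps ^ (P.d + 2) * (P.eps ^ α * P.eps ^ (-((P.d : ℝ) + α))) * (T P 0 x₁ x₂ ^ α * C₂) *
            ∑ j ∈ range k, (((P.L : ℝ) ^ j)⁻¹) ^ ((P.d : ℝ) + α) * Real.exp (-(δ₂ * (m : ℝ) / (P.L : ℝ) ^ j)) := by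
          rw [Finset.mul_sum, Finset.mul_sum]
          refine Finset.sum_congr rfl fun j _ => ?_
          rw [Real.mul_rpow hε.le hT0.le, spacing_pow_inv_mul]
          ring
      _ = P.eps ^ 2 * (T P 0 x₁ x₂ ^ α * C₂) *
            ∑ j ∈ range k, (((P.L : ℝ) ^ j)⁻¹) ^ ((P.d : ℝ) + α) * Real.exp (-(δ₂ * (m : ℝ) / (P.L : ℝ) ^ j)) := by
          rw [eps_collapse₂]
      _ ≤ P.eps ^ 2 * (T P 0 x₁ x₂ ^ α * C₂) * (S₂ / (max (m : ℝ) 1) ^ ((P.d : ℝ) + α)) :=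
          mul_le_mul_of_nonneg_left hS (by positivity)
      _ = C₂ * S₂ * P.eps ^ 2 * (supDist x₁ x₂ : ℝ) ^ α / (max (m : ℝ) 1) ^ ((P.d : ℝ) + α) := by
          rw [T_eq_supDist]; ring
      _ ≤ (C₁ * S₁ + C₂ * S₂) * P.eps ^ 2 * (supDist x₁ x₂ : ℝ) ^ α / (max (m : ℝ) 1) ^ ((P.d : ℝ) + α) := by
          refine div_le_div_of_nonneg_right ?_ (Real.rpow_nonneg hM.le _)
          refine mul_le_mul_of_nonneg_right (mul_le_mul_of_nonneg_right (by nlinarith) (by positivity)) ?_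
          exact Real.rpow_nonneg (Nat.cast_nonneg _) _

end Summed

end

end Literature.MathematicalPhysics.QuantumFieldTheory.BalabanImbrieJaffe1984to88.BIJ85FlatPropagatorKernelHolder
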